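import Summits.QuantumFields.BalabanUV.Beta.GAN24.EnvelopeBlockSum
import Literature.MathematicalPhysics.QuantumFieldTheory.Balaban1983to89.Beta.StepJetData

/-!
# `GAN24.ContactOneGaugeCellBound` — CT-ROUTE step CT-3a, part 2a: «ENVELOPES IN, `L^{d+1}·e^{−κ′·spread}` OUT» — the three-envelope free block sum and
# the generic one-gauge cell bound `|Σ'_u Σ_κ w·T·M| ≤ (d+1)·E_w·E₁·E₃·L^{d+1}·Zl·e^{−(κ₀/12)·spread}`, with the tip ∕ midpoint ∕ site gauge weights

HONEST FRAMING (cell charter, verbatim): «discharging `BetaPertH` makes Bałaban's UV stability UNCONDITIONAL — a real constructive-QFT result;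
it is NOT the continuum limit and NOT the Clay problem.»  DERIVED cell leaf (pub-balaban, G-an2-4 formalisation swarm → CRUX TEAM (2), seat
`b2b-balaban-gan24-formalise-leaf-02`, gen 46; module CT-3a of the row owner's `CT3-MECHANISM.md` v1∕v1.1 §1(c)∕§3): [folklore] real analysis (the triangle
inequality and one free block sum) over leaf-12's `GAN24/EnvelopeBlockSum` BY NAME; NO cited fact, NO `def`, NO `def … : Prop`, NO wall binder; constants
symbolic (no power of the blocking hard-wired).  Discharges NO letter of (CONV-C); NEVER «G-an2-4 closed»; NOT hS0, NOT D1, NOT `BetaPertH`, NOT continuum,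
NOT Clay.  «not in print; our bookkeeping».
HONEST DEPENDENCY (cell records, verbatim): «continuum YM on T⁴ ⇐ BetaPertH ∧ nine spine estimates (0/9 proved); BetaPertH ⇐ (D1) ∧ (D4) ∧ CAP+tail;
G-an2-4 gates asym, D1 and NE2/3/4.»
ABSOLUTE RULE (cell charter, verbatim): «No internally-minted statement may enter as a cited fact. Every hypothesis is either kernel-proved in this
package or a verbatim quotation of a PUBLISHED theorem with page reference. The manuscript(s) under audit are NOT citable for their own disputed steps —
they are the thing under adjudication; programme-internal (2001/route/tribunal) claims are never citable.»

THE OBJECTS (generic `d`, lattice `ℤ^(d+1)`; blocking `L ≥ 1`; rate `κ₀ > 0`; envelope `E_z(u) := e^{−κ₀‖quo L u − z‖∞}` of `RespStepDecay` ∕ `EnvelopeBlockSum`;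
`e_κ := B6BondElimination.unitVec κ`).
## What is proved
* §1 **`tsum_env3_le`** — THE THREE-ENVELOPE FREE BLOCK SUM: `Σ'_u E_{z₀}(u)·E_{z₁}(u)·E_{z₃}(u) ≤ L^{d+1}·Zl(κ₀/(4(d+1)))·e^{−(κ₀/12)(‖z₁−z₀‖∞ + ‖z₃−z₀‖∞)}`
  (leaf-12's `tsum_env4_le` at half rate with the centre `z₀` doubled) — and the summand is summable.
* §2 **`abs_tsum_weight_mul_mul_le`** — THE GENERIC ONE-GAUGE CELL BOUND: `|w κ u| ≤ E_w·E_{z₀}(u)`, `|T κ u| ≤ E₁·E_{z₁}(u)`, `|M κ u| ≤ E₃·E_{z₃}(u)` ⇒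
  `Summable ∧ |Σ'_u Σ_κ w κ u·T κ u·M κ u| ≤ (d+1)·E_w·E₁·E₃·[§1]`; the three gauge weights of the contact cells, each `≤ E_ψ·e^{κ₀}·E_{z₀}(u)` from
  `|ψ x| ≤ E_ψ·E_{z₀}(x)`: `abs_tip_weight_le` (`ψ(u + e_κ)`: one unit step moves the block label by at most one, `env_wobble`), `abs_site_weight_le` (`ψ u`),
  `abs_mid_weight_le` (`½(ψ u + ψ(u + e_κ))`); and the two elementary readings of an envelope hypothesis `abs_le_of_env` (sup bound), `summable_of_env`.
Part 2b (`GAN24.ContactOneGaugeCell`) contracts the cells with these.  Provenance: seat b2b-balaban-gan24-formalise-leaf-02 gen 46 (prover-…-leaf-02-g46-0),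
2026-08-21; over the files named above BY NAME.
-/

namespace Summit.QuantumFields.BalabanUV.Beta.GAN24.ContactOneGaugeCellBound

open Finset
open scoped BigOperators
open Literature.MathematicalPhysics.QuantumFieldTheory.LatticeForm (quo)
open Literature.MathematicalPhysics.QuantumFieldTheory.Balaban1983to89
open Literature.MathematicalPhysics.QuantumFieldTheory.Balaban1983to89.Beta
open B12Sec2to5 (l1 l1_nonneg)
open B4ContourShift (supNorm supNorm_nonneg)
open B4Reflection242 (supNorm_le_of_forall)
open ExpKernelCalculus (Zl Zl_nonneg Zl_pos)
open StepJetData (l1_unitVec)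
open AffineAveraging (Form1)
open B6BondElimination (unitVec unitVec_apply)
open Summit.QuantumFields.BalabanUV.Beta.GAN24.EnvelopeBlockSum (env_wobble env_le_one summable_env tsum_env4_le)

noncomputable section

variable {d : ℕ}

/-! ## §1 The three-envelope free block sum -/

section BlockSum

/-- [folklore] Splitting an envelope into two half-rate factors. -/
theorem exp_env_eq_half_mul_half (κ₀ s : ℝ) : Real.exp (-(κ₀ * s)) = Real.exp (-(κ₀ / 2 * s)) * Real.exp (-(κ₀ / 2 * s)) := by
  rw [← Real.exp_add]; congr 1; ring

/-- [folklore] An envelope is below its half-rate version. -/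
theorem exp_env_le_half {κ₀ s : ℝ} (hκ : 0 ≤ κ₀) (hs : 0 ≤ s) : Real.exp (-(κ₀ * s)) ≤ Real.exp (-(κ₀ / 2 * s)) := by
  rw [Real.exp_le_exp]; nlinarith

/-- [folklore] **THE THREE-ENVELOPE FREE BLOCK SUM**: `Σ'_u E_{z₀}(u)·E_{z₁}(u)·E_{z₃}(u) ≤ L^{d+1}·Zl(κ₀/(4(d+1)))·e^{−(κ₀/12)(‖z₁−z₀‖∞ + ‖z₃−z₀‖∞)}`
for `E_z(u) = e^{−κ₀‖quo L u − z‖∞}` (leaf-12's four-envelope sum `EnvelopeBlockSum.tsum_env4_le` at rate `κ₀/2` with the centre `z₀` doubled). -/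
theorem tsum_env3_le {L : ℕ} (hL : 1 ≤ L) {κ₀ : ℝ} (hκ : 0 < κ₀) (z₀ z₁ z₃ : Fin (d + 1) → ℤ) :
    (Summable fun u : Fin (d + 1) → ℤ => Real.exp (-(κ₀ * supNorm (quo L u - z₀))) * Real.exp (-(κ₀ * supNorm (quo L u - z₁))) *
        Real.exp (-(κ₀ * supNorm (quo L u - z₃)))) ∧
    ∑' u : Fin (d + 1) → ℤ, Real.exp (-(κ₀ * supNorm (quo L u - z₀))) * Real.exp (-(κ₀ * supNorm (quo L u - z₁))) *
        Real.exp (-(κ₀ * supNorm (quo L u - z₃)))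
      ≤ (L : ℝ) ^ (d + 1) * Zl (d + 1) (κ₀ / (4 * ((d : ℝ) + 1))) * Real.exp (-(κ₀ / 12) * (supNorm (z₁ - z₀) + supNorm (z₃ - z₀))) := by
  set F : (Fin (d + 1) → ℤ) → ℝ := fun u => Real.exp (-(κ₀ * supNorm (quo L u - z₀))) * Real.exp (-(κ₀ * supNorm (quo L u - z₁))) *
        Real.exp (-(κ₀ * supNorm (quo L u - z₃))) with hF
  have hFle : ∀ u, |F u| ≤ Real.exp (-(κ₀ * supNorm (quo L u - z₀))) := by
    intro u
    rw [hF]; dsimp only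
    rw [abs_of_pos (by positivity)]
    have h1 := env_le_one (L := L) hκ.le z₁ u
    have h3 := env_le_one (L := L) hκ.le z₃ u
    have h0 : 0 ≤ Real.exp (-(κ₀ * supNorm (quo L u - z₀))) := (Real.exp_pos _).le
    calc _ ≤ Real.exp (-(κ₀ * supNorm (quo L u - z₀))) * 1 * 1 := by gcongr
      _ = _ := by ring
  have hFs : Summable F := Summable.of_norm_bounded (summable_env hL hκ z₀) (fun u => by rw [Real.norm_eq_abs]; exact hFle u)
  refine ⟨hFs, ?_⟩
  have hκ2 : 0 < κ₀ / 2 := by positivity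
  obtain ⟨hGs, hG⟩ := tsum_env4_le (d := d) hL hκ2 z₀ z₀ z₁ z₃
  have hpt : ∀ u, F u ≤ Real.exp (-(κ₀ / 2 * supNorm (quo L u - z₀))) * Real.exp (-(κ₀ / 2 * supNorm (quo L u - z₀))) *
      Real.exp (-(κ₀ / 2 * supNorm (quo L u - z₁))) * Real.exp (-(κ₀ / 2 * supNorm (quo L u - z₃))) := by
    intro u
    rw [hF]; dsimp only
    rw [exp_env_eq_half_mul_half κ₀ (supNorm (quo L u - z₀))]
    have h1 := exp_env_le_half hκ.le (supNorm_nonneg (quo L u - z₁))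
    have h3 := exp_env_le_half hκ.le (supNorm_nonneg (quo L u - z₃))
    gcongr
  have e1 : κ₀ / 2 / (2 * ((d : ℝ) + 1)) = κ₀ / (4 * ((d : ℝ) + 1)) := by
    rw [div_div]; ring_nf
  have e2 : -(κ₀ / 2 / 6) * (supNorm (z₀ - z₀) + supNorm (z₁ - z₀) + supNorm (z₃ - z₀)) =
      -(κ₀ / 12) * (supNorm (z₁ - z₀) + supNorm (z₃ - z₀)) := by
    have h0 : supNorm ((0 : Fin (d + 1) → ℤ)) = 0 :=
      le_antisymm (supNorm_le_of_forall fun i => by simp) (supNorm_nonneg _)   -- `B4BoxCov237.supNorm_zero'`, inlined to keep the import light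
    rw [sub_self, h0]; ring
  rw [e1, e2] at hG
  exact (Summable.tsum_le_tsum hpt hFs hGs).trans hG

end BlockSum

/-! ## §2 The generic cell bound and the three gauge weights -/

section CellBound

/-- [folklore] **THE GENERIC ONE-GAUGE CELL BOUND** — «envelopes in, `L^{d+1}·e^{−κ′·spread}` out»: a weight `w`, a leg `T` and a Maxwell factor `M` with block
envelopes centred at `z₀, z₁, z₃` give `|Σ'_u Σ_κ w κ u·T κ u·M κ u| ≤ (d+1)·E_w·E₁·E₃·L^{d+1}·Zl(κ₀/(4(d+1)))·e^{−(κ₀/12)(‖z₁−z₀‖∞+‖z₃−z₀‖∞)}`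
(and the summand is summable). -/
theorem abs_tsum_weight_mul_mul_le {L : ℕ} (hL : 1 ≤ L) {κ₀ : ℝ} (hκ : 0 < κ₀) {w T M : Form1 (d + 1) ℝ} {z₀ z₁ z₃ : Fin (d + 1) → ℤ}
    {Ew E₁ E₃ : ℝ} (hEw : 0 ≤ Ew) (hE₁ : 0 ≤ E₁) (hE₃ : 0 ≤ E₃)
    (hw : ∀ κ u, |w κ u| ≤ Ew * Real.exp (-(κ₀ * supNorm (quo L u - z₀))))
    (hT : ∀ κ u, |T κ u| ≤ E₁ * Real.exp (-(κ₀ * supNorm (quo L u - z₁))))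
    (hM : ∀ κ u, |M κ u| ≤ E₃ * Real.exp (-(κ₀ * supNorm (quo L u - z₃)))) :
    (Summable fun u => ∑ κ, w κ u * T κ u * M κ u) ∧
    |∑' u, ∑ κ, w κ u * T κ u * M κ u| ≤
      ((d : ℝ) + 1) * Ew * E₁ * E₃ *
        ((L : ℝ) ^ (d + 1) * Zl (d + 1) (κ₀ / (4 * ((d : ℝ) + 1))) * Real.exp (-(κ₀ / 12) * (supNorm (z₁ - z₀) + supNorm (z₃ - z₀)))) := by
  obtain ⟨hPs, hP⟩ := tsum_env3_le (d := d) hL hκ z₀ z₁ z₃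
  set P : (Fin (d + 1) → ℤ) → ℝ := fun u => Real.exp (-(κ₀ * supNorm (quo L u - z₀))) * Real.exp (-(κ₀ * supNorm (quo L u - z₁))) *
        Real.exp (-(κ₀ * supNorm (quo L u - z₃))) with hPdef
  have hpt : ∀ u, |∑ κ, w κ u * T κ u * M κ u| ≤ ((d : ℝ) + 1) * Ew * E₁ * E₃ * P u := by
    intro u
    calc |∑ κ, w κ u * T κ u * M κ u| ≤ ∑ κ, |w κ u * T κ u * M κ u| := Finset.abs_sum_le_sum_abs _ _
      _ ≤ ∑ _κ : Fin (d + 1), Ew * Real.exp (-(κ₀ * supNorm (quo L u - z₀))) * (E₁ * Real.exp (-(κ₀ * supNorm (quo L u - z₁)))) *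
            (E₃ * Real.exp (-(κ₀ * supNorm (quo L u - z₃)))) := Finset.sum_le_sum fun κ _ => by
          rw [abs_mul, abs_mul]
          have h1 := hw κ u
          have h2 := hT κ u
          have h3 := hM κ u
          gcongr
      _ = ((d : ℝ) + 1) * Ew * E₁ * E₃ * P u := by
          rw [Finset.sum_const, Finset.card_univ, Fintype.card_fin, nsmul_eq_mul, hPdef]
          push_cast; ring
  have hgs : Summable (fun u => ((d : ℝ) + 1) * Ew * E₁ * E₃ * P u) := hPs.mul_left _
  refine ⟨Summable.of_norm_bounded hgs (fun u => by rw [Real.norm_eq_abs]; exact hpt u), ?_⟩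
  have h1 : |∑' u, ∑ κ, w κ u * T κ u * M κ u| ≤ ∑' u, ((d : ℝ) + 1) * Ew * E₁ * E₃ * P u := by
    have h := tsum_of_norm_bounded hgs.hasSum (fun u => by rw [Real.norm_eq_abs]; exact hpt u)
    rw [Real.norm_eq_abs] at h
    exact h
  rw [tsum_mul_left] at h1
  exact h1.trans (mul_le_mul_of_nonneg_left hP (by positivity))

variable {L : ℕ} {κ₀ : ℝ} {ψ : (Fin (d + 1) → ℤ) → ℝ} {z₀ : Fin (d + 1) → ℤ} {Eψ : ℝ}

/-- [folklore] **THE TIP WEIGHT** `ψ(u + e_κ)`: `≤ E_ψ·e^{κ₀}·E_{z₀}(u)` (one unit step moves the block label by at most one). -/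
theorem abs_tip_weight_le (hL : 1 ≤ L) (hκ : 0 ≤ κ₀) (hE : 0 ≤ Eψ)
    (hψ : ∀ x, |ψ x| ≤ Eψ * Real.exp (-(κ₀ * supNorm (quo L x - z₀)))) (κ : Fin (d + 1)) (u : Fin (d + 1) → ℤ) :
    |ψ (u + unitVec κ)| ≤ Eψ * Real.exp κ₀ * Real.exp (-(κ₀ * supNorm (quo L u - z₀))) := by
  have hw := env_wobble (L := L) hL hκ z₀ u (u + unitVec κ)
  rw [add_sub_cancel_left, l1_unitVec, mul_one] at hw
  calc |ψ (u + unitVec κ)| ≤ Eψ * Real.exp (-(κ₀ * supNorm (quo L (u + unitVec κ) - z₀))) := hψ _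
    _ ≤ Eψ * (Real.exp κ₀ * Real.exp (-(κ₀ * supNorm (quo L u - z₀)))) := mul_le_mul_of_nonneg_left hw hE
    _ = _ := by ring

/-- [folklore] **THE SITE WEIGHT** `ψ u`: `≤ E_ψ·e^{κ₀}·E_{z₀}(u)` (weakened by `e^{κ₀} ≥ 1` for a uniform statement). -/
theorem abs_site_weight_le (hκ : 0 ≤ κ₀) (hE : 0 ≤ Eψ)
    (hψ : ∀ x, |ψ x| ≤ Eψ * Real.exp (-(κ₀ * supNorm (quo L x - z₀)))) (u : Fin (d + 1) → ℤ) :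
    |ψ u| ≤ Eψ * Real.exp κ₀ * Real.exp (-(κ₀ * supNorm (quo L u - z₀))) := by
  have h1 : (1 : ℝ) ≤ Real.exp κ₀ := Real.one_le_exp hκ
  have h0 : 0 ≤ Eψ * Real.exp (-(κ₀ * supNorm (quo L u - z₀))) := by positivity
  calc |ψ u| ≤ Eψ * Real.exp (-(κ₀ * supNorm (quo L u - z₀))) := hψ u
    _ = Eψ * 1 * Real.exp (-(κ₀ * supNorm (quo L u - z₀))) := by ring
    _ ≤ Eψ * Real.exp κ₀ * Real.exp (-(κ₀ * supNorm (quo L u - z₀))) := by gcongr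

/-- [folklore] **THE MIDPOINT WEIGHT** `½(ψ u + ψ(u + e_κ))`: `≤ E_ψ·e^{κ₀}·E_{z₀}(u)`. -/
theorem abs_mid_weight_le (hL : 1 ≤ L) (hκ : 0 ≤ κ₀) (hE : 0 ≤ Eψ)
    (hψ : ∀ x, |ψ x| ≤ Eψ * Real.exp (-(κ₀ * supNorm (quo L x - z₀)))) (κ : Fin (d + 1)) (u : Fin (d + 1) → ℤ) :
    |(ψ u + ψ (u + unitVec κ)) / 2| ≤ Eψ * Real.exp κ₀ * Real.exp (-(κ₀ * supNorm (quo L u - z₀))) := by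
  have h1 := abs_site_weight_le (L := L) hκ hE hψ u
  have h2 := abs_tip_weight_le hL hκ hE hψ κ u
  rw [abs_div, abs_two]
  have h3 := abs_add_le (ψ u) (ψ (u + unitVec κ))
  linarith

/-- [folklore] A sup bound from a block envelope (the envelope is at most one). -/
theorem abs_le_of_env {L : ℕ} {κ₀ : ℝ} (hκ : 0 ≤ κ₀) {g : (Fin (d + 1) → ℤ) → ℝ} {E : ℝ} (hE : 0 ≤ E) {z : Fin (d + 1) → ℤ}
    (hg : ∀ x, |g x| ≤ E * Real.exp (-(κ₀ * supNorm (quo L x - z)))) (x : Fin (d + 1) → ℤ) : |g x| ≤ E :=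
  (hg x).trans (by have h := env_le_one (L := L) hκ z x; nlinarith)

/-- [folklore] A function under a block envelope is summable. -/
theorem summable_of_env {L : ℕ} (hL : 1 ≤ L) {κ₀ : ℝ} (hκ : 0 < κ₀) {g : (Fin (d + 1) → ℤ) → ℝ} {E : ℝ} {z : Fin (d + 1) → ℤ}
    (hg : ∀ x, |g x| ≤ E * Real.exp (-(κ₀ * supNorm (quo L x - z)))) : Summable g :=
  Summable.of_norm_bounded ((summable_env hL hκ z).mul_left E) (fun x => by rw [Real.norm_eq_abs]; exact hg x)

end CellBound

end

end Summit.QuantumFields.BalabanUV.Beta.GAN24.ContactOneGaugeCellBound
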